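import Summits.ABC.ABC.Theorems.PrimePowerRadical.Negative.WieferichSparse

/-!
# Stub `stub_vojtaShape_of_crux` of line `nevbir-below-beta` (crux stmt-ABC-1648, `PrimePowerRadical`)

Crux (route ABC/IneffectiveSubspace): `Summit.ABC.ABC.Theses.IneffectiveSubspace.PrimePowerRadical`,
at a prime base `q`: `∀ ε > 0, ∃ C > 0, ∀ k ≥ 1, q^k < C · rad(1·(q^k−1)·q^k)^{1+ε}`.

We prove the NECESSARY direction / calibration of the line's typed tower inequality: the crux at `q`
already implies every Vojta-shape instance of `TowerIneq q n c b_H b_Y ε F` (weights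
`c_i = b_H = b_Y = b` with `0 < b < 1/3`, `ε = 0`, no exceptional curve `F = 1`), i.e. with
`m := q^k − 1`, `h := k log q`, `v_p := v_p(m)`, `j_p := v_p(u)` for `u ∣ m`:
`3b·h − b·log u ≤ h − Σ_{p ∣ m} (Σ_{i<n} b·min(v_p − i·j_p, j_p)) log p + C`.
The statement `stub_vojtaShape_of_crux` is the registered stub with the skeleton-local definitions
`TowerIneq` / `towerG` of `Cruxes/PrimePowerRadical/Lines/nevbir_below_beta.lean` unfolded (the lead glues
it back by `unfold`).

Proof sketch.
1. COMBINATORICS (`vshape_sum_min_eq`): `Σ_{i<n} min(v − i·j, j) = min(v, n·j)` (ℕ-subtraction), hence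
   `Σ_{i<n} min(v − i·j, j) + 1 ≤ v + j` whenever `v ≥ 1` (`vshape_sum_min_add_one_le`).
2. SUMS (`vshape_towerSum_le`): writing `log u`, `log m`, `log rad m` as sums over the prime factors of
   `m`, step 1 gives termwise `Σ_p (Σ_i b·min) log p ≤ b·log u + b·(log m − log rad m)`.
3. CRUX INPUT: apply the crux with `δ := (1 − 3b)/b > 0` (so `b(1+δ) = 1 − 2b`); by
   `Negative.rad_family_eq`, `q^k < C_δ (rad m · q)^{1+δ}`; taking logs,
   `b·h < b·log C_δ + (1 − 2b)(log rad m + log q)`.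
4. ASSEMBLE: with `log rad m ≤ log m ≤ h` the four inequalities combine linearly to the claim with
   `C := b·log C_δ + (1 − 2b)·log q`.

Sources: the line's card `Cruxes/PrimePowerRadical/Ideas/nevbir-below-beta.md` (BarrierNotes B3: "Yasufuku's
inequality at the crux points is the crux verbatim"); bookkeeping modelled on
`Negative.wieferichSparse_of_PPRAt` (`Theorems/PrimePowerRadical/Negative/WieferichSparse.lean`).
Deliberately NOT here: the converse cash-out (`stub_cashout`), any geometric statement about the towers.
-/

noncomputable section

-- `Summit.<Summit>.<Problem>` is the mandated summit-side namespace (CONVENTIONS §2); for the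
-- single-conjunct summit `ABC` the two coincide, so the duplicate `ABC.ABC` is deliberate.
set_option linter.dupNamespace false

namespace Summit.ABC.ABC.Theorems.PrimePowerRadical.NevbirBelowBeta

open Literature.NumberTheory.DiophantineGeometry UniqueFactorizationMonoid
open Summit.ABC.ABC.Theses.IneffectiveSubspace
open Summit.ABC.ABC.Theorems.PrimePowerRadical.Negative
open scoped BigOperators

/-! ## Step 1: the combinatorial identity of the exceptional-divisor multiplicities -/

/-- **Full tower capture identity.** For natural numbers `v, j, n`:
`Σ_{i<n} min(v − i·j, j) = min(v, n·j)` (ℕ-subtraction, i.e. positive parts). -/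
theorem vshape_sum_min_eq (v j n : ℕ) :
    ∑ i ∈ Finset.range n, min (v - i * j) j = min v (n * j) := by
  induction n with
  | zero => simp
  | succ n ih =>
    rw [Finset.sum_range_succ, ih, add_mul, one_mul]
    generalize n * j = t
    omega

/-- Consequence used termwise: if `1 ≤ v` then `Σ_{i<n} min(v − i·j, j) + 1 ≤ v + j`
(for `j = 0` the sum vanishes; for `j ≥ 1` it is `≤ v`). -/
theorem vshape_sum_min_add_one_le {v : ℕ} (hv : 1 ≤ v) (j n : ℕ) :
    ∑ i ∈ Finset.range n, min (v - i * j) j + 1 ≤ v + j := by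
  rw [vshape_sum_min_eq]
  rcases Nat.eq_zero_or_pos j with rfl | hj
  · simpa using hv
  · have := min_le_left v (n * j)
    omega

/-! ## Step 2: the tower sum against `log u` and the powerful excess `log m − log rad m` -/

/-- **The tower sum is at most `b·log u + b·log(m / rad m)`.** For `m ≠ 0`, `u ∣ m`, `0 ≤ b`:
`Σ_{p ∣ m} (Σ_{i<n} b·min(v_p(m) − i·v_p(u), v_p(u))) log p ≤ b·log u + b·(log m − log rad m)`. -/
theorem vshape_towerSum_le {m u : ℕ} (hm : m ≠ 0) (hu : u ∣ m) (n : ℕ) {b : ℝ} (hb : 0 ≤ b) :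
    ∑ p ∈ m.primeFactors, (∑ i ∈ Finset.range n,
        b * ((min (m.factorization p - i * u.factorization p) (u.factorization p) : ℕ) : ℝ))
          * Real.log p
      ≤ b * Real.log u + b * (Real.log m - Real.log (radical m : ℕ)) := by
  -- `log u`, `log m`, `log rad m` as sums over the prime factors of `m`
  have hlogu : Real.log u = ∑ p ∈ m.primeFactors, (u.factorization p : ℝ) * Real.log p := by
    rw [Real.log_nat_eq_sum_factorization, Finsupp.sum, Nat.support_factorization]
    apply Finset.sum_subset (Nat.primeFactors_mono hu hm)
    intro p _ hpu
    have h0 : u.factorization p = 0 := by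
      rw [← Finsupp.notMem_support_iff, Nat.support_factorization]
      exact hpu
    simp [h0]
  have hlogm : Real.log m = ∑ p ∈ m.primeFactors, (m.factorization p : ℝ) * Real.log p := by
    rw [Real.log_nat_eq_sum_factorization, Finsupp.sum, Nat.support_factorization]
  have hlogr : Real.log (radical m : ℕ) = ∑ p ∈ m.primeFactors, Real.log (p : ℝ) := by
    rw [Nat.radical_eq_prod_primeFactors, Nat.cast_prod, Real.log_prod]
    intro p hp
    exact_mod_cast (Nat.prime_of_mem_primeFactors hp).ne_zero
  rw [hlogu, hlogm, hlogr, ← Finset.sum_sub_distrib, Finset.mul_sum, Finset.mul_sum,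
    ← Finset.sum_add_distrib]
  apply Finset.sum_le_sum
  intro p hp
  have hpr : p.Prime := Nat.prime_of_mem_primeFactors hp
  have hv : 1 ≤ m.factorization p :=
    hpr.factorization_pos_of_dvd hm (Nat.dvd_of_mem_primeFactors hp)
  have hc : 0 ≤ b * Real.log (p : ℝ) := mul_nonneg hb (Real.log_natCast_nonneg p)
  have key : (∑ i ∈ Finset.range n,
      ((min (m.factorization p - i * u.factorization p) (u.factorization p) : ℕ) : ℝ)) + 1
        ≤ (m.factorization p : ℝ) + (u.factorization p : ℝ) := by
    exact_mod_cast vshape_sum_min_add_one_le hv (u.factorization p) n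
  have h2 := mul_le_mul_of_nonneg_left key hc
  rw [← Finset.mul_sum]
  linarith

/-! ## Steps 3–4: the crux input in logarithms and the assembly -/

/-- **`stub_vojtaShape_of_crux` (NECESSARY direction; calibration).** The crux at the prime `q`
(`∀ ε > 0 ∃ C > 0 ∀ k ≥ 1, q^k < C·rad(1·(q^k−1)·q^k)^{1+ε}`) implies every Vojta-shape instance of the
typed tower inequality of the line `nevbir-below-beta`: for `0 < b < 1/3`, every level `n`,
`c_i = b_H = b_Y = b`, `ε = 0`, `F = 1` (the registered stub `TowerIneq q n (fun _ => b) b b 0 1` with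
`TowerIneq`/`towerG` unfolded). Proof: `Σ_{i<n} min(v − ij, j) = min(v, nj)`, `log u ≥ Σ_{p∣u} log p`,
so `towerSum − b·log u ≤ b·log(m / rad m)` (`vshape_towerSum_le`), while the crux at exponent
`1 + (1−3b)/b` gives `b·k log q < b·log C₀ + (1 − 2b)(log rad m + log q)`; with `log rad m ≤ log m ≤ k log q`
these combine linearly to the claim with `C := b·log C₀ + (1 − 2b)·log q`. -/
theorem stub_vojtaShape_of_crux {q : ℕ} (hq : q.Prime)
    (h : ∀ ε : ℝ, 0 < ε → ∃ C : ℝ, 0 < C ∧ ∀ k : ℕ, 1 ≤ k →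
      ((q ^ k : ℕ) : ℝ) < C * ((rad 1 (q ^ k - 1) (q ^ k) : ℕ) : ℝ) ^ (1 + ε))
    (n : ℕ) {b : ℝ} (hb0 : 0 < b) (hb : b < 1 / 3) :
    ∃ C : ℝ, ∀ k : ℕ, 1 ≤ k → ∀ u : ℕ, u ∣ q ^ k - 1 →
      MvPolynomial.eval ![((q : ℤ) ^ k), (u : ℤ)] (1 : MvPolynomial (Fin 2) ℤ) ≠ 0 →
        b * (2 * ((k : ℝ) * Real.log q)) + b * ((k : ℝ) * Real.log q - Real.log u)
          ≤ (1 + 0) * ((k : ℝ) * Real.log q -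
              ∑ p ∈ (q ^ k - 1).primeFactors,
                (∑ i ∈ Finset.range n, b *
                  ((min ((q ^ k - 1).factorization p - i * u.factorization p) (u.factorization p) : ℕ) : ℝ))
                * Real.log p) + C := by
  -- the crux at exponent `1 + δ`, `δ := (1 - 3b)/b > 0`, so that `b (1 + δ) = 1 - 2b`
  have h3b : 0 < 1 - 3 * b := by linarith
  have hδ0 : 0 < (1 - 3 * b) / b := div_pos h3b hb0
  have hbt : b * (1 + (1 - 3 * b) / b) = 1 - 2 * b := by
    field_simp
    ring
  obtain ⟨C₀, hC₀, hC⟩ := h ((1 - 3 * b) / b) hδ0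
  have hq0 : (0 : ℝ) < q := by exact_mod_cast hq.pos
  refine ⟨b * Real.log C₀ + (1 - 2 * b) * Real.log q, fun k hk u hu _ => ?_⟩
  have hm0 : q ^ k - 1 ≠ 0 := by have := two_le_pow hq.two_le hk; omega
  have hR0 : (0 : ℝ) < ((radical (q ^ k - 1) : ℕ) : ℝ) := by exact_mod_cast Nat.radical_pos _
  -- the crux instance, casts normalised: `q^k < C₀ (rad m · q)^(1+δ)`
  have h1 : (q : ℝ) ^ k <
      C₀ * (((radical (q ^ k - 1) : ℕ) : ℝ) * q) ^ (1 + (1 - 3 * b) / b) := by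
    have := hC k hk
    rw [rad_family_eq hq hk] at this
    push_cast at this
    exact this
  -- in logarithms: `k log q < log C₀ + (1+δ) (log rad m + log q)`
  have hlog : (k : ℝ) * Real.log q <
      Real.log C₀ + (1 + (1 - 3 * b) / b) *
        (Real.log ((radical (q ^ k - 1) : ℕ) : ℝ) + Real.log q) := by
    have hpos : (0 : ℝ) < (q : ℝ) ^ k := by positivity
    have := Real.log_lt_log hpos h1
    rwa [Real.log_pow, Real.log_mul hC₀.ne' (by positivity), Real.log_rpow (by positivity),
      Real.log_mul hR0.ne' hq0.ne'] at this
  -- times `b`: `b h < b log C₀ + (1 - 2b) (log rad m + log q)`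
  have hkey : b * ((k : ℝ) * Real.log q) <
      b * Real.log C₀ + (1 - 2 * b) * (Real.log ((radical (q ^ k - 1) : ℕ) : ℝ) + Real.log q) := by
    calc b * ((k : ℝ) * Real.log q)
        < b * (Real.log C₀ + (1 + (1 - 3 * b) / b) *
            (Real.log ((radical (q ^ k - 1) : ℕ) : ℝ) + Real.log q)) :=
          mul_lt_mul_of_pos_left hlog hb0
      _ = b * Real.log C₀ + b * (1 + (1 - 3 * b) / b) *
            (Real.log ((radical (q ^ k - 1) : ℕ) : ℝ) + Real.log q) := by ring
      _ = b * Real.log C₀ + (1 - 2 * b) *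
            (Real.log ((radical (q ^ k - 1) : ℕ) : ℝ) + Real.log q) := by rw [hbt]
  -- `log m ≤ k log q` and `log rad m ≤ log m`
  have hmpos : (0 : ℝ) < ((q ^ k - 1 : ℕ) : ℝ) := by exact_mod_cast Nat.pos_of_ne_zero hm0
  have hlogm : Real.log ((q ^ k - 1 : ℕ) : ℝ) ≤ (k : ℝ) * Real.log q := by
    rw [← Real.log_pow]
    apply Real.log_le_log hmpos
    exact_mod_cast Nat.sub_le (q ^ k) 1
  have hlogR : Real.log ((radical (q ^ k - 1) : ℕ) : ℝ) ≤ Real.log ((q ^ k - 1 : ℕ) : ℝ) := by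
    apply Real.log_le_log hR0
    exact_mod_cast Nat.le_of_dvd (Nat.pos_of_ne_zero hm0) radical_dvd_self
  -- the tower sum against `b log u + b (log m - log rad m)`
  have hG := vshape_towerSum_le hm0 hu n hb0.le
  have h3 : b * Real.log ((q ^ k - 1 : ℕ) : ℝ) ≤ b * ((k : ℝ) * Real.log q) :=
    mul_le_mul_of_nonneg_left hlogm hb0.le
  have h4 : (1 - 3 * b) * Real.log ((radical (q ^ k - 1) : ℕ) : ℝ) ≤
      (1 - 3 * b) * ((k : ℝ) * Real.log q) :=
    mul_le_mul_of_nonneg_left (hlogR.trans hlogm) h3b.le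
  linarith

end Summit.ABC.ABC.Theorems.PrimePowerRadical.NevbirBelowBeta

end
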